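import Mathlib.Data.Fintype.Card
import Mathlib.Data.Set.Card
import Mathlib.Data.Finset.Card
import Mathlib.Data.Finset.Union
import Literature.ModelTheory.FiniteModelTheory.CkEquiv
import HarnessLib

/-!
# Duplicator strategies from local consistency: the Cai–Fürer–Immerman / Atserias–Dawar transfer

Topic `Literature/ModelTheory/FiniteModelTheory`; support file for the discharge of the named fact
`AtseriasDawarOchremiak2021_hamiltonicity_countingWidth` (`CountingWidth.lean`; linear counting width of
Hamiltonicity, Atserias–Dawar–Ochremiak 2021, Lemma 14 of arXiv:1901.07825).

All linear lower bounds on counting width in print rest on one mechanism (Cai–Fürer–Immerman 1992, §6;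
Atserias–Bulatov–Dawar 2009; Atserias–Dawar 2019, Lemma 3.2 = arXiv:1806.11307 Lemma 2: "we describe a
strategy for Duplicator in the `k`-pebble bijective game played on `G(I)` and `G(I⁰)`, given a strategy in
the existential `k`-pebble game on `I` … we use this to define the bijection taking `x_l^a` to
`x_l^{a+f(x_l)}`"): two structures built over the SAME system of parity constraints differ by a "twist" of
the right-hand sides; flipping the value of a variable is an isomorphism between neighbouring twists that
moves only the vertices owned by that variable; and a family of LOCALLY CONSISTENT partial assignments
(non-empty, closed under restriction, extendable one variable at a time below a size bound `K`, each member
satisfying the constraints inside its domain) tells Duplicator which flips to announce. This file proves the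
mechanism ONCE, abstractly, in the vocabulary of the tree's bijective pebble game (`BijPebbleStrategy`,
`CkEquiv`, file `CkEquiv.lean`):

* `IsConsistencyFamily Good K` — the four closure properties of a family `Good dom f` of partial assignments
  (domain `dom : Finset V`, values read off `f : V → R` on `dom`), i.e. a winning strategy for Duplicator in the
  existential pebble game with fewer than `K` pebbles (Atserias–Dawar 2019, §2.1, "`k`-locally satisfiable");
* `IsLocalFlipAction D φ` — a map `φ : (V → R) → (W ≃ W)` ("flip by `f`") that is LOCAL for a data map
  `D : W → Finset V` (the image of `x` depends only on `f` restricted to `D x`) and preserves the data;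
* `ckEquiv_of_consistencyFamily` — **the transfer theorem**: if moreover every good `(dom, f)` makes `φ f` a
  partial isomorphism `Γ → Γ'` on the vertices whose data lies inside `dom`, and `|D x| ≤ c₀` for all `x`, then
  `Γ ≡^{C^k} Γ'` whenever `c₀ k ≤ K`. Duplicator's positions are the sets of pairs `(x, φ f x)` with `(dom, f)`
  good for the data of the pebbled vertices; her bijection is the patchwork of the flips `φ f_E` over the data
  classes `{x | D x = E}`, `f_E` a good extension of the current assignment to `E` — exactly the printed
  strategy, with "variable `x_l`" generalised to "the data `D x` of the vertex `x`" so that the same theorem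
  serves vertices owned by a constraint (data = its three variables) and gadget vertices of a graph encoding;
* `IsConsistencyFamily.extend_finset` — extension to a whole finite set of variables below the bound;
* `CkEquiv.iso_congr` — transport of `≡^{C^k}` along graph isomorphisms on both sides (the strategy is pushed
  forward pair by pair), used to move constructions to vertex types `Fin n`.

## References

* A. Atserias, A. Dawar, *Definable inapproximability: new challenges for duplicator*, J. Log. Comput. 29
  (2019), arXiv:1806.11307, §2.1 (existential and bijective `k`-pebble games), Lemma 3.2 (= Lemma 2 of the
  arXiv text) and its proof. Read: arXiv pp. 6–10.
* J.-Y. Cai, M. Fürer, N. Immerman, *An optimal lower bound on the number of variables for graph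
  identification*, Combinatorica 12 (1992) 389–410, §6 (the original twist-and-flip argument).
* A. Atserias, A. Dawar, J. Ochremiak, *On the power of symmetric linear programs*, J. ACM 68 (2021) Art. 26,
  arXiv:1901.07825, §5.2 (where the mechanism is invoked for Hamiltonicity through Theorem 3 and Lemma 14).
-/

namespace Literature.ModelTheory.FiniteModelTheory

open Finset

/-! ### Transport of `≡^{C^k}` along isomorphisms -/

namespace CkEquiv

variable {α β α' β' : Type*} {G : SimpleGraph α} {H : SimpleGraph β} {G' : SimpleGraph α'}
  {H' : SimpleGraph β'} {k : ℕ}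

/-- **`≡^{C^k}` is invariant under isomorphisms on both sides**: if `G ≡^{C^k} H`, `G ≃g G'` and `H ≃g H'`
then `G' ≡^{C^k} H'`. Duplicator translates every position through the two isomorphisms and announces the
conjugated bijection. [folklore] -/
theorem iso_congr (h : CkEquiv k G H) (e : G ≃g G') (e' : H ≃g H') : CkEquiv k G' H' := by
  obtain ⟨S⟩ := h
  -- the translation of pairs
  let Φ : α × β ≃ α' × β' := e.toEquiv.prodCongr e'.toEquiv
  have hpre : ∀ p' : Set (α' × β'), Φ '' (Φ ⁻¹' p') = p' := fun p' =>
    Set.image_preimage_eq p' Φ.surjective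
  have hnc : ∀ p' : Set (α' × β'), (Φ ⁻¹' p').ncard = p'.ncard := fun p' => by
    conv_rhs => rw [← hpre p']
    rw [Set.ncard_image_of_injective _ Φ.injective]
  have hins : ∀ (z : α' × β') (p' : Set (α' × β')),
      Φ ⁻¹' (insert z p') = insert (Φ.symm z) (Φ ⁻¹' p') := fun z p' => by
    ext x
    simp only [Set.mem_preimage, Set.mem_insert_iff, Equiv.apply_eq_iff_eq_symm_apply]
  refine ⟨{ carrier := {p' | Φ ⁻¹' p' ∈ S.carrier}
            empty_mem := by
              show Φ ⁻¹' (∅ : Set (α' × β')) ∈ S.carrier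
              rw [Set.preimage_empty]; exact S.empty_mem
            finite_of_mem := fun p' hp' => by
              rw [← hpre p']; exact (S.finite_of_mem hp').image Φ
            ncard_le_of_mem := fun p' hp' => (hnc p') ▸ S.ncard_le_of_mem hp'
            isPartialIso_of_mem := fun p' hp' => ?_
            mem_of_subset := fun p' hp' q' hq' => S.mem_of_subset hp' (Set.preimage_mono hq')
            forth := fun p' hp' hlt => ?_ }⟩
  · have hP := S.isPartialIso_of_mem hp'
    refine ⟨fun x hx y hy => ?_, fun x hx y hy => ?_⟩
    · obtain ⟨x, rfl⟩ := Φ.surjective x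
      obtain ⟨y, rfl⟩ := Φ.surjective y
      have := hP.eq_iff hx hy
      simp only [Φ, Equiv.prodCongr_apply, Prod.map_fst, Prod.map_snd]
      rw [e.toEquiv.injective.eq_iff, e'.toEquiv.injective.eq_iff]
      exact this
    · obtain ⟨x, rfl⟩ := Φ.surjective x
      obtain ⟨y, rfl⟩ := Φ.surjective y
      have := hP.adj_iff hx hy
      simp only [Φ, Equiv.prodCongr_apply, Prod.map_fst, Prod.map_snd]
      show G'.Adj (e x.1) (e y.1) ↔ H'.Adj (e' x.2) (e' y.2)
      rw [e.map_adj_iff, e'.map_adj_iff]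
      exact this
  · obtain ⟨f, hf⟩ := S.forth hp' ((hnc p').symm ▸ hlt)
    refine ⟨e.toEquiv.symm.trans (f.trans e'.toEquiv), fun a' => ?_⟩
    have heq : Φ.symm (a', (e.toEquiv.symm.trans (f.trans e'.toEquiv)) a') =
        (e.toEquiv.symm a', f (e.toEquiv.symm a')) :=
      Prod.ext rfl (e'.toEquiv.symm_apply_apply _)
    show Φ ⁻¹' _ ∈ S.carrier
    rw [hins, heq]
    exact hf (e.toEquiv.symm a')

end CkEquiv

/-! ### Consistency families and local flip actions -/

section Transfer

variable {V R W : Type*} [DecidableEq V]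

/-- **A consistency family with bound `K`** ("`K`-local satisfiability", Atserias–Dawar 2019, §2.1 and
§3.1: a winning strategy for Duplicator in the existential pebble game): a family `Good dom f` of partial
assignments — `f : V → R` read on the finite domain `dom` only (`congr`) — containing every assignment on the
empty domain, closed under shrinking the domain, and such that every member whose domain has fewer than `K`
variables extends to any further variable. (The constraint-satisfaction part of the printed notion — members
are partial homomorphisms — is not needed for the abstract transfer and is supplied by the user through the
compatibility hypothesis of `ckEquiv_of_consistencyFamily`.)
[cite: AtseriasDawar2019, §2.1 (existential k-pebble game; k-locally satisfiable, §3.1)] -/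
structure IsConsistencyFamily (Good : Finset V → (V → R) → Prop) (K : ℕ) : Prop where
  /-- every assignment is good on the empty domain -/
  empty : ∀ f, Good ∅ f
  /-- shrinking the domain keeps an assignment good -/
  mono : ∀ ⦃dom dom' : Finset V⦄ ⦃f : V → R⦄, Good dom f → dom' ⊆ dom → Good dom' f
  /-- only the values on the domain matter -/
  congr : ∀ ⦃dom : Finset V⦄ ⦃f g : V → R⦄, Good dom f → (∀ v ∈ dom, f v = g v) → Good dom g
  /-- the extension property below `K` -/
  extend : ∀ ⦃dom : Finset V⦄ ⦃f : V → R⦄, Good dom f → dom.card < K → ∀ v : V,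
    ∃ g : V → R, Good (insert v dom) g ∧ ∀ w ∈ dom, g w = f w

/-- **Extension to a finite set of variables**: a good assignment whose domain leaves room for `E`
(`|dom| + |E| ≤ K`) extends to a good assignment on `E ∪ dom` agreeing with it on `dom` (iterate the
one-variable extension). [cite: AtseriasDawar2019, §3.1 ("at least one of the satisfying assignments … can be
extended to any other variable … and itself satisfying the same type of extension property")] -/
theorem IsConsistencyFamily.extend_finset {Good : Finset V → (V → R) → Prop} {K : ℕ}
    (hG : IsConsistencyFamily Good K) {dom : Finset V} {f : V → R} (hf : Good dom f) (E : Finset V)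
    (hE : dom.card + E.card ≤ K) : ∃ g : V → R, Good (E ∪ dom) g ∧ ∀ w ∈ dom, g w = f w := by
  induction E using Finset.induction_on with
  | empty => exact ⟨f, by simpa using hf, fun w _ => rfl⟩
  | @insert v E hv ih =>
    rw [Finset.card_insert_of_notMem hv] at hE
    obtain ⟨g, hg, hgf⟩ := ih (by omega)
    have hcard : (E ∪ dom).card < K := (Finset.card_union_le _ _).trans_lt (by omega)
    obtain ⟨g', hg', hg'g⟩ := hG.extend hg hcard v
    refine ⟨g', by simpa [Finset.insert_union] using hg', fun w hw => ?_⟩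
    rw [hg'g w (Finset.mem_union_right _ hw), hgf w hw]

/-- **A local flip action**: `φ f : W ≃ W` ("flip the vertices by `f`") moves a vertex `x` in a way that
depends only on the values of `f` on the data `D x ⊆ V` of `x`, and does not change the data. In the
printed argument `W` is the set of copies `x_l^a` of the variables, `D x_l^a = {x_l}` and
`φ f (x_l^a) = x_l^{a + f(x_l)}`. [cite: AtseriasDawar2019, Lemma 3.2 (proof: "the bijection taking x_l^a to
x_l^{a+f(x_l)}")] -/
structure IsLocalFlipAction (D : W → Finset V) (φ : (V → R) → W ≃ W) : Prop where
  /-- locality: the image of `x` depends only on `f` restricted to `D x` -/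
  local_apply : ∀ (f g : V → R) (x : W), (∀ v ∈ D x, f v = g v) → φ f x = φ g x
  /-- flips preserve the data -/
  data_apply : ∀ (f : V → R) (x : W), D (φ f x) = D x

variable [Fintype W]

/-- The data of a (finite) position: the union of the data of its pebbled left vertices. [folklore] -/
noncomputable def positionData (D : W → Finset V) (P : Set (W × W)) : Finset V :=
  (Set.toFinite P).toFinset.biUnion fun z => D z.1

/-- The data of a pebbled vertex lies in the data of the position. [folklore] -/
theorem subset_positionData (D : W → Finset V) {P : Set (W × W)} {z : W × W} (hz : z ∈ P) :
    D z.1 ⊆ positionData D P :=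
  Finset.subset_biUnion_of_mem (fun z : W × W => D z.1) ((Set.Finite.mem_toFinset _).2 hz)

/-- The data of a sub-position is contained in the data of the position. [folklore] -/
theorem positionData_mono (D : W → Finset V) {P Q : Set (W × W)} (h : Q ⊆ P) :
    positionData D Q ⊆ positionData D P := by
  intro v hv
  simp only [positionData, Finset.mem_biUnion, Set.Finite.mem_toFinset] at hv ⊢
  obtain ⟨z, hz, hvz⟩ := hv
  exact ⟨z, h hz, hvz⟩

/-- Pebbling one more pair adds the data of its left vertex. [folklore] -/
theorem positionData_insert (D : W → Finset V) (P : Set (W × W)) (z : W × W) :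
    positionData D (insert z P) = D z.1 ∪ positionData D P := by
  ext v
  simp only [positionData, Finset.mem_biUnion, Set.Finite.mem_toFinset, Set.mem_insert_iff,
    Finset.mem_union]
  constructor
  · rintro ⟨w, rfl | hw, hvw⟩
    · exact Or.inl hvw
    · exact Or.inr ⟨w, hw, hvw⟩
  · rintro (hv | ⟨w, hw, hvw⟩)
    · exact ⟨z, Or.inl rfl, hv⟩
    · exact ⟨w, Or.inr hw, hvw⟩

/-- With data of size at most `c₀` per vertex, a position with `p` pairs has data of size at most `c₀ p`.
[folklore] -/
theorem card_positionData_le (D : W → Finset V) {c₀ : ℕ} (hD : ∀ x, (D x).card ≤ c₀)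
    (P : Set (W × W)) : (positionData D P).card ≤ c₀ * P.ncard := by
  unfold positionData
  refine (Finset.card_biUnion_le).trans ?_
  rw [Set.ncard_eq_toFinset_card P (Set.toFinite P)]
  calc ∑ z ∈ (Set.toFinite P).toFinset, (D z.1).card
      ≤ ∑ _z ∈ (Set.toFinite P).toFinset, c₀ := Finset.sum_le_sum fun z _ => hD z.1
    _ = c₀ * (Set.toFinite P).toFinset.card := by rw [Finset.sum_const, smul_eq_mul, mul_comm]

/-- **The transfer theorem** (Atserias–Dawar 2019, Lemma 3.2, abstract form; Cai–Fürer–Immerman 1992, §6).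
Let `Good` be a consistency family with bound `K` and `φ` a local flip action for the data map `D` with
`|D x| ≤ c₀`, and suppose that whenever `(dom, f)` is good, `φ f` preserves and reflects adjacency between
any two vertices whose data lies in `dom` (the partial-isomorphism property that the printed proof derives
from "each pebbled equation is satisfied by the pebbled values"). Then `Γ ≡^{C^k} Γ'` for every `k` with
`c₀ k ≤ K`: Duplicator keeps the pebbled pairs of the form `(x, φ f x)` for one good `(dom, f)` containing
the data of all pebbled vertices, and announces the bijection `x ↦ φ f_{D x} x`, where `f_E` is a good
extension of `f` to `E` (it exists while `|dom| + c₀ ≤ K`, and the patchwork is a bijection because flips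
preserve data classes). [cite: AtseriasDawar2019, Lemma 3.2] -/
theorem ckEquiv_of_consistencyFamily [Inhabited R] {Good : Finset V → (V → R) → Prop} {K c₀ k : ℕ}
    (hG : IsConsistencyFamily Good K) {D : W → Finset V} {φ : (V → R) → W ≃ W}
    (hφ : IsLocalFlipAction D φ) (hD : ∀ x, (D x).card ≤ c₀) {Γ Γ' : SimpleGraph W}
    (hcompat : ∀ (dom : Finset V) (f : V → R) (x y : W), Good dom f → D x ⊆ dom → D y ⊆ dom →
      (Γ'.Adj (φ f x) (φ f y) ↔ Γ.Adj x y))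
    (hk : c₀ * k ≤ K) : CkEquiv k Γ Γ' := by
  classical
  refine ⟨{ carrier := {P | P.ncard ≤ k ∧ ∃ f : V → R, Good (positionData D P) f ∧
              ∀ z ∈ P, z.2 = φ f z.1}
            empty_mem := ?_
            finite_of_mem := fun P _ => Set.toFinite P
            ncard_le_of_mem := fun P hP => hP.1
            isPartialIso_of_mem := ?_
            mem_of_subset := ?_
            forth := ?_ }⟩
  · refine ⟨by simp, default, ?_, fun z hz => (Set.notMem_empty z hz).elim⟩
    have h0 : positionData D (∅ : Set (W × W)) = ∅ := by
      ext v; simp [positionData]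
    rw [h0]
    exact hG.empty _
  · rintro P ⟨-, f, hf, hP⟩
    refine ⟨fun x hx y hy => ?_, fun x hx y hy => ?_⟩
    · rw [hP x hx, hP y hy]
      exact (φ f).injective.eq_iff.symm
    · rw [hP x hx, hP y hy]
      exact (hcompat _ f x.1 y.1 hf (subset_positionData D hx) (subset_positionData D hy)).symm
  · rintro P ⟨hPk, f, hf, hP⟩ Q hQP
    exact ⟨(Set.ncard_le_ncard hQP (Set.toFinite P)).trans hPk, f,
      hG.mono hf (positionData_mono D hQP), fun z hz => hP z (hQP hz)⟩
  · rintro P ⟨hPk, f, hf, hP⟩ hlt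
    -- room for the data of one more vertex
    have hroom : ∀ x : W, (positionData D P).card + (D x).card ≤ K := fun x => by
      have h1 := card_positionData_le D hD P
      have h2 : c₀ * P.ncard + c₀ ≤ c₀ * k := by
        have : P.ncard + 1 ≤ k := hlt
        rw [← Nat.mul_succ]
        exact Nat.mul_le_mul_left _ this
      exact (Nat.add_le_add h1 (hD x)).trans (h2.trans hk)
    -- a good extension for every data class
    have hext : ∀ E : Finset V, ∃ g : V → R, (∃ x : W, D x = E) →
        Good (E ∪ positionData D P) g ∧ ∀ w ∈ positionData D P, g w = f w := by
      intro E
      by_cases hE : ∃ x : W, D x = E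
      · obtain ⟨x, rfl⟩ := hE
        obtain ⟨g, hg⟩ := hG.extend_finset hf (D x) (hroom x)
        exact ⟨g, fun _ => hg⟩
      · exact ⟨f, fun h => (hE h).elim⟩
    choose gE hgE using hext
    -- Duplicator's bijection: flip each vertex by the extension chosen for its data class
    let g : W → W := fun x => φ (gE (D x)) x
    have hginj : Function.Injective g := by
      intro x y hxy
      have hD' : D x = D y := by
        have := congrArg D hxy
        simpa only [g, hφ.data_apply] using this
      have : φ (gE (D x)) x = φ (gE (D x)) y := by simpa only [g, hD'] using hxy
      exact (φ _).injective this
    refine ⟨Equiv.ofBijective g hginj.bijective_of_finite, fun x => ?_⟩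
    by_cases hx : (x, g x) ∈ P
    · rw [Equiv.ofBijective_apply, Set.insert_eq_of_mem hx]
      exact ⟨hPk, f, hf, hP⟩
    refine ⟨?_, gE (D x), ?_, ?_⟩
    · rw [Equiv.ofBijective_apply, Set.ncard_insert_of_notMem hx (Set.toFinite P)]
      exact hlt
    · rw [positionData_insert]
      exact ((hgE (D x)) ⟨x, rfl⟩).1
    · rintro z (rfl | hz)
      · rfl
      · rw [hP z hz]
        refine hφ.local_apply _ _ _ fun v hv => ?_
        exact (((hgE (D x)) ⟨x, rfl⟩).2 v (subset_positionData D hz hv)).symm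

end Transfer

end Literature.ModelTheory.FiniteModelTheory
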